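import Mathlib
import Literature.Topology.FourManifolds.PlanarAchiralWords
import Summits.SmoothPoincare4.SmoothPoincare4.Theorems.ConvexBisectionPlanarAcyclicBisectionRigidityHelperReachMon
import HarnessLib

/-!
# Crux `ConvexBisection.PlanarAcyclicBisectionRigidity`, line Sketch (skeleton v2.0) — helper
# `helper_reachable_normallyGenerates_all`

Pure algebra on the definitions of `Literature/Topology/FourManifolds/PlanarAchiralWords.lean`
(arc data `ArcData n` of `Mod(D_n, ∂)`, `evalWord`, the curve classes `PlanarCurve.cls`, the five
moves `Move` and the orbit relation `Reachable`), reusing the landed infrastructure of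
`…StubWalkLow` (sub-namespace `WalkLow`: `aut_mul`, `aut_one`, `evalWord_append`),
`…HelperSeamNG` (`SeamNG.twist_perm`, `SeamNG.twist_u_mem`, `SeamNG.aut_mul_inv_mem`,
`SeamNG.evalWord_mul_invWord`) and `…HelperReachMon` (`ReachMon.evalWord_invWord_mul`,
`ReachMon.invWord_twistWord`, the level embedding `ReachMon.lift` with `lift_aut`,
`evalWord_succ`, `blockWord_succ`).

* THE JOINT NORMAL CLOSURE OF ALL LETTER CLASSES IS AN ORBIT INVARIANT.  The closed 4-manifold of
  a state `(n, w)` is `X_w ∪ ♮(S¹ × B³)` with `π₁ = F_n ⧸ ⟪cls l : l ∈ w⟫`; every move re-reads the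
  same manifold, so "`π₁ = 1`", i.e. `⟪cls l : l ∈ w⟫ = F_n`, is an orbit invariant
  (`ReachNG.move_iff`, `ReachNG.reachable_iff`; no new definition is introduced, the letter-class
  set of the registered signature is abbreviated by a local notation).  Letter by letter:
  - rotation permutes the letters;
  - the signed Hurwitz move (and its inverse) replaces one class `[d]` by `(T_c^{±})_*[d]`, where
    `c` is another letter of BOTH states, and `(T_c^{±})_*(v) · v⁻¹ ∈ ⟪[c]⟫` for every `v`
    (`ReachNG.twist_aut_mul_inv_mem`: `SeamNG.twist_u_mem` for the positive twist, the inverse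
    automorphism for the negative one), so the two letter sets have the same normal closure;
  - global conjugation by `g` applies the AUTOMORPHISM `g_*` (two-sided inverse `(g⁻¹)_*`,
    `ReachNG.aut_invWord_aut`) to every class (`ReachNG.cls_image`), and "normally generates" is
    transported along surjective homomorphisms (`ReachNG.nc_eq_top_of_surjective`);
  - planar stabilisation `(n, w) ↦ (n + 1, γ⁺ γ⁻ w)`, `γ = g(c_[m,n])`, is the Tietze move: with
    `ι : F_n ↪ F_{n+1}` the old classes become `ι [l]` (`ReachNG.cls_succ`) and
    `[γ] = ι(u) · x_n` with `u = g_*(x_m ⋯ x_{n-1}) ∈ F_n` (`ReachNG.cls_stab`; no hypothesis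
    on `u` is needed afterwards); so
    `⟪ι S, ι(u) x_n⟫ ⊇ ι⟪S⟫ = ι F_n ∋ x_0, …, x_{n-1}` and `x_n = ι(u)⁻¹ · [γ]`, all generators
    (`ReachNG.nc_top_succ`); conversely the retraction `ρ : F_{n+1} ↠ F_n`, `x_i ↦ x_i (i < n)`,
    `x_n ↦ u⁻¹` (`ReachNG.exists_retr`) is the identity on `ι F_n` and kills `[γ]`.
* CONCLUSION (`helper_reachable_normallyGenerates_all`): an integral homotopy-sphere word has
  `⟪cls (A ++ B)⟫ = F_n` (`sphere`), the block form `A · B̄ʳᵉᵛ` has the same letter curves, and the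
  invariant propagates along `Reachable`: every reachable state is again a homotopy-sphere word
  (all its letter classes normally generate `F_{n'}`).  Uses nothing unproved.
-/

noncomputable section

open Literature.Topology.FourManifolds Literature.Topology.FourManifolds.PlanarWords

-- the prescribed namespace `Summit.<S>.<P>.…` repeats `SmoothPoincare4` (S = P = SmoothPoincare4)
set_option linter.dupNamespace false

namespace Summit.SmoothPoincare4.SmoothPoincare4.Theorems.PlanarAcyclicBisectionRigidity.Sketch

namespace ReachNG

open ArcData PGen WalkLow SeamNG ReachMon

variable {n : ℕ}

/-! ## Normal generation: transport along (surjective) homomorphisms -/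

/-- Transport of normal generation along a SURJECTIVE homomorphism `f`: if `S` normally generates
`G` and `f` maps `S` into the normal closure of `T`, then `T` normally generates `H` (the preimage
of `⟪T⟫` is a normal subgroup containing `S`). [folklore] -/
theorem nc_eq_top_of_surjective {G H : Type*} [Group G] [Group H] (f : G →* H)
    (hf : Function.Surjective f) {S : Set G} {T : Set H}
    (hST : ∀ x ∈ S, f x ∈ Subgroup.normalClosure T) (hS : Subgroup.normalClosure S = ⊤) :
    Subgroup.normalClosure T = ⊤ := by
  have hle : Subgroup.normalClosure S ≤ (Subgroup.normalClosure T).comap f :=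
    Subgroup.normalClosure_le_normal fun x hx => hST x hx
  rw [eq_top_iff]
  intro y _
  obtain ⟨x, rfl⟩ := hf y
  have hx : x ∈ Subgroup.normalClosure S := by rw [hS]; exact Subgroup.mem_top x
  exact hle hx

/-! ## The set of letter classes of a state; the invariant "the letter classes normally generate" -/

/-- Membership in the set `{[l] : l ∈ w}` of letter classes of a state `(n, w)` (the set of the
registered signature, written verbatim throughout: no abbreviation is introduced). [folklore] -/
theorem mem_CS {w : List Letter} {x : FreeGroup (Fin n)} :
    x ∈ {x | x ∈ w.map fun l => PlanarCurve.cls n l.1} ↔ ∃ l ∈ w, PlanarCurve.cls n l.1 = x := by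
  simp only [Set.mem_setOf_eq, List.mem_map]

/-- The class of a letter of `w` lies in the normal closure of the letter classes of `w`.
[folklore] -/
theorem cls_mem_nc {w : List Letter} {l : Letter} (hl : l ∈ w) :
    PlanarCurve.cls n l.1 ∈
      Subgroup.normalClosure {x | x ∈ w.map fun l => PlanarCurve.cls n l.1} :=
  Subgroup.subset_normalClosure (mem_CS.2 ⟨l, hl, rfl⟩)

/-- A property holds on the set of letter classes iff it holds at the class of every letter.
[folklore] -/
theorem forall_CS_iff {w : List Letter} {P : FreeGroup (Fin n) → Prop} :
    (∀ x ∈ {x | x ∈ w.map fun l => PlanarCurve.cls n l.1}, P x) ↔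
      ∀ l ∈ w, P (PlanarCurve.cls n l.1) := by
  constructor
  · intro h l hl
    exact h _ (mem_CS.2 ⟨l, hl, rfl⟩)
  · intro h x hx
    obtain ⟨l, hl, rfl⟩ := mem_CS.1 hx
    exact h l hl

/-- Normal generation passes from the letter classes of `(n, v)` to those of `(k, w)` along a
surjective homomorphism `F_n ↠ F_k` mapping every class of `v` into the normal closure of the
classes of `w`. [folklore] -/
theorem NG_of_surjective {k : ℕ} {v w : List Letter}
    (f : FreeGroup (Fin n) →* FreeGroup (Fin k)) (hf : Function.Surjective f)
    (h : ∀ l ∈ v, f (PlanarCurve.cls n l.1) ∈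
      Subgroup.normalClosure {x | x ∈ w.map fun l => PlanarCurve.cls k l.1})
    (hv : Subgroup.normalClosure {x | x ∈ v.map fun l => PlanarCurve.cls n l.1} = ⊤) :
    Subgroup.normalClosure {x | x ∈ w.map fun l => PlanarCurve.cls k l.1} = ⊤ :=
  nc_eq_top_of_surjective f hf (forall_CS_iff.2 h) hv

/-- Normal generation passes from the letter classes of `v` to those of `w` (same number of
holes) as soon as every class of `v` lies in the normal closure of the classes of `w`. [folklore] -/
theorem NG_of_subset {v w : List Letter}
    (h : ∀ l ∈ v, PlanarCurve.cls n l.1 ∈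
      Subgroup.normalClosure {x | x ∈ w.map fun l => PlanarCurve.cls n l.1})
    (hv : Subgroup.normalClosure {x | x ∈ v.map fun l => PlanarCurve.cls n l.1} = ⊤) :
    Subgroup.normalClosure {x | x ∈ w.map fun l => PlanarCurve.cls n l.1} = ⊤ :=
  NG_of_surjective (MonoidHom.id _) Function.surjective_id h hv

/-- The block form `A · B̄ʳᵉᵛ` has the letter curves `A ++ B`: `NormallyGenerates n (A ++ B)` is
normal generation by the letter classes of `blockForm A B`. [folklore] -/
theorem NG_blockForm {A B : List PlanarCurve} (h : NormallyGenerates n (A ++ B)) :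
    Subgroup.normalClosure {x | x ∈ (blockForm A B).map fun l => PlanarCurve.cls n l.1} = ⊤ := by
  unfold NormallyGenerates at h
  rw [← h]
  congr 1
  ext x
  simp [blockForm, positiveWord, List.mem_map, List.mem_reverse, List.mem_append]

/-! ## Classes of image curves; the automorphism of a word and its inverse -/

/-- The class of the image curve `h(c)` is `h_*[c]`. [folklore] -/
theorem cls_image (h : List PGen) (c : PlanarCurve) :
    (PlanarCurve.image h c).cls n = (evalWord n h).aut (c.cls n) := by
  simp only [PlanarCurve.cls, PlanarCurve.image, evalWord_append, aut_mul, MonoidHom.comp_apply]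

/-- The class of the Hurwitz image `T_c^{ε}(d)` is `(T_c^{ε})_*[d]`. [folklore] -/
theorem cls_hurwitzAct (x y : Letter) :
    (hurwitzAct x y).1.cls n = (evalWord n (x.1.twistWord x.2)).aut (y.1.cls n) :=
  cls_image _ _

/-- `(g⁻¹)_* ∘ g_* = id` on `F_n` (on-the-nose inverse pair `g⁻¹ · g = 1`). [folklore] -/
theorem aut_invWord_aut (g : List PGen) (v : FreeGroup (Fin n)) :
    (evalWord n (invWord g)).aut ((evalWord n g).aut v) = v := by
  have h := congrArg ArcData.aut (evalWord_invWord_mul (n := n) g)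
  rw [aut_mul, aut_one] at h
  exact DFunLike.congr_fun h v

/-- `g_* ∘ (g⁻¹)_* = id` on `F_n`. [folklore] -/
theorem aut_aut_invWord (g : List PGen) (v : FreeGroup (Fin n)) :
    (evalWord n g).aut ((evalWord n (invWord g)).aut v) = v := by
  simpa only [invWord_invWord] using aut_invWord_aut (invWord g) v

/-- `g_*` is surjective (indeed an automorphism of `F_n`). [folklore] -/
theorem aut_surjective (g : List PGen) : Function.Surjective (evalWord n g).aut :=
  fun v => ⟨_, aut_aut_invWord g v⟩

/-! ## Signed twists act trivially modulo the class of their curve -/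

/-- For every signed twist `T_c^{±}` and every `v ∈ F_n`: `(T_c^{±})_*(v) · v⁻¹ ∈ ⟪[c]⟫`
(positive sign: `π(T_c) = 1` and the arc words of `T_c` lie in `⟪[c]⟫`, `SeamNG`; negative sign:
`T_c⁻ = (T_c)⁻¹` as arc data, and `v · w⁻¹ ∈ N ⇒ w · v⁻¹ ∈ N` with `w = (T_c⁻)_* v`,
`v = (T_c)_* w`).
[folklore] -/
theorem twist_aut_mul_inv_mem (c : PlanarCurve) (s : Bool) (v : FreeGroup (Fin n)) :
    (evalWord n (c.twistWord s)).aut v * v⁻¹ ∈ Subgroup.normalClosure {c.cls n} := by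
  cases s with
  | true => exact aut_mul_inv_mem _ _ (twist_perm c) (twist_u_mem c) v
  | false =>
    have e : c.twistWord false = invWord (c.twistWord true) := (invWord_twistWord c true).symm
    have h1 : (evalWord n (c.twistWord true)).aut ((evalWord n (c.twistWord false)).aut v) = v := by
      rw [e]
      exact aut_aut_invWord _ v
    have h2 := aut_mul_inv_mem _ _ (twist_perm c) (twist_u_mem c)
      ((evalWord n (c.twistWord false)).aut v)
    rw [h1] at h2
    simpa using inv_mem h2

/-- If a normal subgroup contains `[c]` and `v`, it contains `(T_c^{±})_* v`. [folklore] -/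
theorem twist_aut_mem {N : Subgroup (FreeGroup (Fin n))} [N.Normal] (c : PlanarCurve) (s : Bool)
    (v : FreeGroup (Fin n)) (hc : c.cls n ∈ N) (hv : v ∈ N) :
    (evalWord n (c.twistWord s)).aut v ∈ N := by
  have h := Subgroup.normalClosure_le_normal (N := N) (Set.singleton_subset_iff.2 hc)
    (twist_aut_mul_inv_mem c s v)
  simpa using mul_mem h hv

/-- If a normal subgroup contains `[c]` and `(T_c^{±})_* v`, it contains `v`. [folklore] -/
theorem mem_of_twist_aut_mem {N : Subgroup (FreeGroup (Fin n))} [N.Normal] (c : PlanarCurve)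
    (s : Bool) (v : FreeGroup (Fin n)) (hc : c.cls n ∈ N)
    (hv : (evalWord n (c.twistWord s)).aut v ∈ N) : v ∈ N := by
  have h := Subgroup.normalClosure_le_normal (N := N) (Set.singleton_subset_iff.2 hc)
    (twist_aut_mul_inv_mem c s v)
  simpa using mul_mem (inv_mem h) hv

/-! ## Stabilisation: classes one level up, the Tietze step on the last generator -/

/-- The round block `x_m ⋯ x_n` on `n + 1` holes (`m ≤ n`) is `ι(x_m ⋯ x_{n-1}) · x_n`, the first
factor being `blockWord n m n` (on `n` holes the bound `b = n` is vacuous: holes `≥ n` are ignored,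
so no `ℕ`-subtraction is needed). [folklore] -/
theorem blockWord_succ_last {m : ℕ} (hm : m ≤ n) :
    blockWord (n + 1) m n =
      FreeGroup.map Fin.castSucc (blockWord n m n) * FreeGroup.of (Fin.last n) := by
  unfold blockWord
  have h1 : ([Fin.last n].filter fun i : Fin (n + 1) => decide (m ≤ i.val ∧ i.val ≤ n))
      = [Fin.last n] := by
    simp [hm]
  rw [List.finRange_succ_last, List.filter_append, h1, List.map_append, List.prod_append]
  congr 1
  rw [List.filter_map, map_list_prod, List.map_map, List.map_map]
  congr 1

/-- The class of the stabilising curve `γ = g(c_[m,n])` on `n + 1` holes is `ι(u) · x_n` with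
`u = g_*(x_m ⋯ x_{n-1}) = g_*(blockWord n m n) ∈ F_n` (`g`, supported below the new hole, lifts to
`ι`-equivariant arc data fixing `x_n`: `ReachMon.evalWord_succ`, `lift_aut`). [folklore] -/
theorem cls_stab {m : ℕ} (g : List PGen) (hm : m ≤ n) (hg : ∀ x ∈ g, x.below n = true) :
    PlanarCurve.cls (n + 1) ⟨m, n, g⟩ =
      FreeGroup.map Fin.castSucc ((evalWord n g).aut (blockWord n m n)) *
        FreeGroup.of (Fin.last n) := by
  simp only [PlanarCurve.cls]
  rw [evalWord_succ g hg, blockWord_succ_last hm, MonoidHom.map_mul, lift_aut, aut_of, lift_u_last,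
    lift_perm_last]
  simp

/-- The class of an in-range curve on `n + 1` holes is `ι` of its class on `n` holes. [folklore] -/
theorem cls_succ (c : PlanarCurve) (hc : c.InRange n) :
    c.cls (n + 1) = FreeGroup.map Fin.castSucc (c.cls n) := by
  obtain ⟨-, hb, hg⟩ := hc
  simp only [PlanarCurve.cls]
  rw [evalWord_succ c.g hg, blockWord_succ hb, lift_aut]

/-- TIETZE, forward: if `S` normally generates `F_n`, `ι S ⊆ ⟪T⟫` and `ι(u) · x_n ∈ ⟪T⟫` for some
`u ∈ F_n`, then `T` normally generates `F_{n+1}` (`⟪T⟫ ⊇ ι⟪S⟫ = ι F_n ∋ x_i`, `i < n`, and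
`x_n = ι(u)⁻¹ · (ι(u) x_n)`). [folklore] -/
theorem nc_top_succ (S : Set (FreeGroup (Fin n))) (T : Set (FreeGroup (Fin (n + 1))))
    (u : FreeGroup (Fin n)) (hS : Subgroup.normalClosure S = ⊤)
    (hST : ∀ x ∈ S, FreeGroup.map Fin.castSucc x ∈ Subgroup.normalClosure T)
    (hu : FreeGroup.map Fin.castSucc u * FreeGroup.of (Fin.last n) ∈ Subgroup.normalClosure T) :
    Subgroup.normalClosure T = ⊤ := by
  have hle : Subgroup.normalClosure S ≤
      (Subgroup.normalClosure T).comap (FreeGroup.map Fin.castSucc) :=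
    Subgroup.normalClosure_le_normal fun x hx => hST x hx
  have hι : ∀ x, FreeGroup.map Fin.castSucc x ∈ Subgroup.normalClosure T := fun x =>
    hle (by rw [hS]; exact Subgroup.mem_top x)
  have hlast : FreeGroup.of (Fin.last n) ∈ Subgroup.normalClosure T := by
    simpa using mul_mem (inv_mem (hι u)) hu
  have hgen : ∀ i : Fin (n + 1), FreeGroup.of i ∈ Subgroup.normalClosure T := fun i => by
    cases i using Fin.lastCases with
    | last => exact hlast
    | cast j => simpa [FreeGroup.map.of] using hι (FreeGroup.of j)
  rw [eq_top_iff, ← FreeGroup.closure_range_of, Subgroup.closure_le]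
  rintro _ ⟨i, rfl⟩
  exact hgen i

/-- TIETZE, backward: the retraction `ρ_u : F_{n+1} ↠ F_n`, `x_i ↦ x_i` (`i < n`), `x_n ↦ u⁻¹`:
a homomorphism that is the identity on `ι F_n` (hence surjective) and sends `x_n` to `u⁻¹` (hence
kills `ι(u) · x_n`). [folklore] -/
theorem exists_retr (u : FreeGroup (Fin n)) :
    ∃ ρ : FreeGroup (Fin (n + 1)) →* FreeGroup (Fin n),
      (∀ x, ρ (FreeGroup.map Fin.castSucc x) = x) ∧ ρ (FreeGroup.of (Fin.last n)) = u⁻¹ := by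
  refine ⟨FreeGroup.lift (Fin.snoc (α := fun _ => FreeGroup (Fin n)) FreeGroup.of u⁻¹),
    fun x => ?_, by simp⟩
  have h : (FreeGroup.lift (Fin.snoc (α := fun _ => FreeGroup (Fin n)) FreeGroup.of u⁻¹)).comp
      (FreeGroup.map Fin.castSucc) = MonoidHom.id _ :=
    FreeGroup.ext_hom _ _ fun j => by simp [FreeGroup.map.of]
  exact DFunLike.congr_fun h x

/-! ## The invariant along the moves and the orbit -/

/-- Every move preserves "all letter classes normally generate", in both directions.
[folklore] -/
theorem move_iff {s t : ℕ × List Letter} (h : Move s t) :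
    (Subgroup.normalClosure {x | x ∈ s.2.map fun l => PlanarCurve.cls s.1 l.1} = ⊤ ↔
      Subgroup.normalClosure {x | x ∈ t.2.map fun l => PlanarCurve.cls t.1 l.1} = ⊤) := by
  cases h with
  | rotate n l w =>
    dsimp only
    constructor <;> refine NG_of_subset fun l' hl' => cls_mem_nc ?_ <;>
      simp only [List.mem_cons, List.mem_append] at hl' ⊢ <;> tauto
  | hurwitz n pre post x y =>
    dsimp only
    constructor
    · refine NG_of_subset fun l hl => ?_
      simp only [List.mem_append, List.mem_cons] at hl
      rcases hl with hl | hl | hl | hl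
      · exact cls_mem_nc (by simp [hl])
      · rw [hl]; exact cls_mem_nc (by simp)
      · rw [hl]
        refine mem_of_twist_aut_mem x.1 x.2 _ (cls_mem_nc (by simp)) ?_
        rw [← cls_hurwitzAct x y]
        exact cls_mem_nc (by simp)
      · exact cls_mem_nc (by simp [hl])
    · refine NG_of_subset fun l hl => ?_
      simp only [List.mem_append, List.mem_cons] at hl
      rcases hl with hl | hl | hl | hl
      · exact cls_mem_nc (by simp [hl])
      · rw [hl, cls_hurwitzAct x y]
        exact twist_aut_mem x.1 x.2 _ (cls_mem_nc (by simp)) (cls_mem_nc (by simp))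
      · rw [hl]; exact cls_mem_nc (by simp)
      · exact cls_mem_nc (by simp [hl])
  | hurwitzInv n pre post x y =>
    dsimp only
    constructor
    · refine NG_of_subset fun l hl => ?_
      simp only [List.mem_append, List.mem_cons] at hl
      rcases hl with hl | hl | hl | hl
      · exact cls_mem_nc (by simp [hl])
      · rw [hl]
        refine mem_of_twist_aut_mem y.1 (!y.2) _ (cls_mem_nc (by simp)) ?_
        rw [← cls_hurwitzAct (y.1, !y.2) x]
        exact cls_mem_nc (by simp)
      · rw [hl]; exact cls_mem_nc (by simp)
      · exact cls_mem_nc (by simp [hl])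
    · refine NG_of_subset fun l hl => ?_
      simp only [List.mem_append, List.mem_cons] at hl
      rcases hl with hl | hl | hl | hl
      · exact cls_mem_nc (by simp [hl])
      · rw [hl]; exact cls_mem_nc (by simp)
      · rw [hl, cls_hurwitzAct (y.1, !y.2) x]
        exact twist_aut_mem y.1 (!y.2) _ (cls_mem_nc (by simp)) (cls_mem_nc (by simp))
      · exact cls_mem_nc (by simp [hl])
  | conj n g w =>
    dsimp only
    constructor
    · refine NG_of_surjective (evalWord n g).aut (aut_surjective g) fun l hl => ?_
      rw [← cls_image]
      exact cls_mem_nc (l := (PlanarCurve.image g l.1, l.2)) (List.mem_map.2 ⟨l, hl, rfl⟩)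
    · refine NG_of_surjective (evalWord n (invWord g)).aut (aut_surjective _) fun l hl => ?_
      obtain ⟨l', hl', rfl⟩ := List.mem_map.1 hl
      dsimp only
      rw [cls_image, aut_invWord_aut]
      exact cls_mem_nc hl'
  | stabilize n m g w hm hg hw =>
    dsimp only
    have hγ := cls_stab g hm hg
    constructor
    · intro H
      refine nc_top_succ _ _ ((evalWord n g).aut (blockWord n m n)) H (fun x hx => ?_) ?_
      · obtain ⟨l, hl, rfl⟩ := mem_CS.1 hx
        rw [← cls_succ l.1 (hw l hl)]
        exact cls_mem_nc (by simp [hl])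
      · rw [← hγ]
        exact cls_mem_nc (l := ((⟨m, n, g⟩, true) : Letter)) (by simp)
    · intro H
      obtain ⟨ρ, hρ, hρn⟩ := exists_retr ((evalWord n g).aut (blockWord n m n))
      have hρ' : ρ (PlanarCurve.cls (n + 1) ⟨m, n, g⟩) = 1 := by
        rw [hγ, map_mul, hρ, hρn, mul_inv_cancel]
      refine NG_of_surjective ρ (fun x => ⟨_, hρ x⟩) (fun l hl => ?_) H
      simp only [List.mem_cons] at hl
      rcases hl with hl | hl | hl
      · rw [hl, hρ']; exact one_mem _
      · rw [hl, hρ']; exact one_mem _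
      · rw [cls_succ l.1 (hw l hl), hρ]; exact cls_mem_nc hl

/-- "All letter classes normally generate" is an invariant of the orbit `Reachable` (moves and
their inverses). [folklore] -/
theorem reachable_iff {s t : ℕ × List Letter} (h : Reachable s t) :
    (Subgroup.normalClosure {x | x ∈ s.2.map fun l => PlanarCurve.cls s.1 l.1} = ⊤ ↔
      Subgroup.normalClosure {x | x ∈ t.2.map fun l => PlanarCurve.cls t.1 l.1} = ⊤) := by
  unfold Reachable at h
  induction h with
  | refl => exact Iff.rfl
  | tail _ hbc ih => exact ih.trans (hbc.elim move_iff fun h' => (move_iff h').symm)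

end ReachNG

/-- **Helper of line Sketch (v2.0) — the walk stays among homotopy-sphere words.**  For an
integral homotopy-sphere word `(n; A, B)` the classes of ALL letters of the block form `A · B̄ʳᵉᵛ`
normally generate `F_n` (`sphere`: `π₁(X_A ∪ X̄_B) = 1`), and this is an invariant of the orbit of
the planar walk (`ReachNG.reachable_iff`): rotation permutes the letters; a signed Hurwitz move
changes one class by the twist automorphism of a letter present in both states, which is the
identity modulo that letter's class; global conjugation applies a free-group automorphism to every
class; planar (de)stabilisation is the Tietze move adding the generator `x_n` together with the
relator `[γ] = ι(u) · x_n`.  Hence at every reachable state `(n', w')` the letter classes again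
normally generate `F_{n'}` (`π₁ = 1`). [folklore] -/
theorem helper_reachable_normallyGenerates_all (n n' : ℕ) (A B : List PlanarCurve)
    (w' : List Letter) (hw : IsIntegralSphereWord n A B)
    (hr : Reachable (n, blockForm A B) (n', w')) :
    Subgroup.normalClosure {x | x ∈ w'.map fun l => PlanarCurve.cls n' l.1} = ⊤ :=
  (ReachNG.reachable_iff hr).1 (ReachNG.NG_blockForm hw.sphere)

end Summit.SmoothPoincare4.SmoothPoincare4.Theorems.PlanarAcyclicBisectionRigidity.Sketch

end
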